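import Summits.NavierStokesRegularity.FluidComputer.SobolevLadderRange
import Summits.NavierStokesRegularity.FluidComputer.LipRowClock
import HarnessLib

/-!
# Fluid computer — the `ℓ¹` ladder (L51's currency `∑_j 2^{sj} ‖Δ̇_j u‖₂`, i.e. `Ḃ^s_{2,1}`) on the WHOLE range
# `1/2 < s ≤ 5/2`: optimal rate for every `s < 5/2` (from the `ℓ²` rows, `ℓ¹ ≥ ℓ²`) and the absolute clock at `s = 5/2` (L61)

HONEST FRAMING (cell `pub-fluidc`, verbatim): *low prior, high value-of-information experiment on Tao's
machine paradigm; NOT a claim that NS blows up.* Theorem side of the cell (the level dictionary); nothing here is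
evidence of blow-up — necessities for EVERY maximal smooth finite-energy solution on `ℝ³`.

L51 (`SobolevLadder.ladder_clock`) gave the `ℓ¹` rows `L_s(t) = ∑_j 2^{sj} a_j(t)` the optimal clock
`c_s ν^{(5−2s)/4}(T − t)^{−(2s−1)/4}` for `1/2 < s ≤ 3/2` only. Since `ℓ¹ ≥ ℓ²` (`∑_j 2^{2sj}a_j² ≤ L_s²`,
`tsum_weight_sq_le_ladder_sq`), the `ℓ²` rows of `SobolevLadderRange.row_clock` (`1 < κ = 2s < 5`) extend it:

* `ladder_clock_range` — for EVERY `s ∈ (1/2, 5/2)` one `c_s > 0` with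
  `c_s ν^{(5−2s)/4} (T − t)^{−(2s−1)/4} ≤ ∑_j 2^{sj} ‖Δ̇_j u(t)‖₂` at every `t ∈ (0, T)` — the `Ḃ^s_{2,1}` ladder at the optimal
  rate on the whole open range;
* `ladder_clock_five_halves` — at `s = 5/2` the clock is L61's: `c (T − t)^{−1} ≤ ∑_j 2^{5j/2} ‖Δ̇_j u(t)‖₂` with `c` ABSOLUTE
  (`ν^{(5−2s)/4} = ν⁰`): the `ℓ¹` ladder CLOSES at the Lipschitz level with no viscosity and no energy, where the `ℓ²`/`Ḣ^s`
  ladder (L52–L58) stops short (`s < 5/2`);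
* `ladder_clock_full` — the two glued: one statement on the CLOSED range `s ∈ (1/2, 5/2]` in L51's format;
* `ladder_tendsto_top_range` — every `ℓ¹` row `s ∈ (1/2, 5/2]` tends to `∞` as `t ↑ T`.

0 sorry; no definitions; no named facts.

## References

* J. C. Robinson, W. Sadowski, R. P. Silva, J. Math. Phys. 53 (2012) 115618, (1.2), §IV. [RobinsonSadowskiSilva2012]
* D. S. McCormick et al., SIAM J. Math. Anal. 48 (2016) 2119–2132, Thm. 1.1. [MccormickEtAl2016]
-/

noncomputable section

open MeasureTheory Set Function Filter Topology
open scoped ENNReal NNReal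
open Literature.Analysis.FluidPDE Literature.Analysis.FunctionSpaces
open Summit.NavierStokesRegularity.FluidComputer.SobolevLadderRange
open Summit.NavierStokesRegularity.FluidComputer.LipRowClock
open Summit.NavierStokesRegularity.FluidComputer.SobolevLadderFront (tendsto_ofReal_clock_top)

namespace Summit.NavierStokesRegularity.FluidComputer.LadderRangeL1

/-- **`ℓ¹ ≥ ℓ²` for the weighted rows**: `∑_j 2^{κj} a_j² ≤ (∑_j 2^{(κ/2)j} a_j)²` for every real `κ` and every
`a : ℤ → [0, ∞]`. [folklore] -/
theorem tsum_weight_sq_le_ladder_sq (κ : ℝ) (a : ℤ → ℝ≥0∞) :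
    ∑' j : ℤ, (2 : ℝ≥0∞) ^ (κ * (j : ℝ)) * a j ^ 2 ≤ (∑' j : ℤ, (2 : ℝ≥0∞) ^ (κ / 2 * (j : ℝ)) * a j) ^ 2 := by
  set x : ℤ → ℝ≥0∞ := fun j => (2 : ℝ≥0∞) ^ (κ / 2 * (j : ℝ)) * a j with hx
  rw [← RiccatiSummationGen.tsum_half_sq κ a]
  calc ∑' j : ℤ, ((2 : ℝ≥0∞) ^ (κ / 2 * (j : ℝ)) * a j) ^ 2 = ∑' j : ℤ, x j * x j := tsum_congr fun j => by rw [hx, sq]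
    _ ≤ ∑' j : ℤ, x j * ∑' k : ℤ, x k := ENNReal.tsum_le_tsum fun j => mul_le_mul' le_rfl (ENNReal.le_tsum j)
    _ = (∑' j : ℤ, x j) * ∑' k : ℤ, x k := ENNReal.tsum_mul_right
    _ = (∑' j : ℤ, x j) ^ 2 := (sq _).symm

/-- **THE `ℓ¹` LADDER ON THE WHOLE OPEN RANGE `1/2 < s < 5/2`.** For every `s ∈ (1/2, 5/2)` there is `c = c_s > 0` such
that for every `ν > 0`, `T > 0`, every maximal smooth solution `(u, p)` of the unforced Navier–Stokes system on
`ℝ³ × [0, T)` which is Leray–Hopf from `u 0`, and EVERY `t ∈ (0, T)`: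
`c · ν^{(5−2s)/4} · (T − t)^{−(2s−1)/4} ≤ ∑_{j∈ℤ} 2^{sj} ‖Δ̇_j u(t)‖₂` — L51 (`s ≤ 3/2`) extended to the optimal rate on
`(3/2, 5/2)` through the `ℓ²` rows (`SobolevLadderRange.row_clock` at `κ = 2s`, and `ℓ¹ ≥ ℓ²`).
[cite: RobinsonSadowskiSilva2012, (1.2), §IV] -/
theorem ladder_clock_range (s : ℝ) (hs : s ∈ Ioo (1 / 2 : ℝ) (5 / 2)) :
    ∃ c : ℝ, 0 < c ∧ ∀ (ν T : ℝ), 0 < ν → 0 < T →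
      ∀ (u : ℝ → EuclideanSpace ℝ (Fin 3) → EuclideanSpace ℝ (Fin 3)) (p : ℝ → EuclideanSpace ℝ (Fin 3) → ℝ),
      IsMaximalSmoothSolution ν 0 u p T → IsLerayHopfOn T ν 0 (u 0) u →
      ∀ t ∈ Ioo 0 T,
        ENNReal.ofReal (c * ν ^ ((5 - 2 * s) / 4) * (T - t) ^ (-((2 * s - 1) / 4))) ≤
          ∑' j : ℤ, (2 : ℝ≥0∞) ^ (s * (j : ℝ)) * blockL2 (u t) j := by
  obtain ⟨c, hc, H⟩ := row_clock (κ := 2 * s) ⟨by linarith [hs.1], by linarith [hs.2]⟩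
  refine ⟨c ^ (1 / 2 : ℝ), by positivity, fun ν T hν hT u p hmax hLH t ht => ?_⟩
  have hTt : 0 < T - t := sub_pos.2 ht.2
  have h1 := H ν T hν hT u p hmax hLH t ht
  have h2 := tsum_weight_sq_le_ladder_sq (2 * s) (blockL2 (u t))
  rw [show 2 * s / 2 = s by ring] at h2
  have h3 := ENNReal.rpow_le_rpow (h1.trans h2) (by norm_num : (0 : ℝ) ≤ 1 / 2)
  have hX : ((∑' j : ℤ, (2 : ℝ≥0∞) ^ (s * (j : ℝ)) * blockL2 (u t) j) ^ 2) ^ (1 / 2 : ℝ) =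
      ∑' j : ℤ, (2 : ℝ≥0∞) ^ (s * (j : ℝ)) * blockL2 (u t) j := by
    rw [← ENNReal.rpow_natCast, ← ENNReal.rpow_mul]; norm_num
  have hA : 0 ≤ c * ν ^ ((5 - 2 * s) / 2) * (T - t) ^ (-((2 * s - 1) / 2)) := by positivity
  rw [hX, ENNReal.ofReal_rpow_of_nonneg hA (by norm_num)] at h3
  refine le_trans (le_of_eq ?_) h3
  congr 1
  rw [Real.mul_rpow (by positivity) (Real.rpow_nonneg hTt.le _), Real.mul_rpow hc.le (Real.rpow_nonneg hν.le _),
    ← Real.rpow_mul hν.le, ← Real.rpow_mul hTt.le]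
  congr 2 <;> ring

/-- **THE `ℓ¹` LADDER AT ITS TOP RUNG `s = 5/2`: the clock is ABSOLUTE** — `c · ν⁰ · (T − t)^{−1} ≤ ∑_j 2^{5j/2} ‖Δ̇_j u(t)‖₂`
with `c` free of `ν` and of the energy (L61, `LipRowClock.lipRow_clock`, written in the ladder's format: at `s = 5/2`,
`(5 − 2s)/4 = 0` and `(2s − 1)/4 = 1`). The `ℓ¹`/`Ḃ^s_{2,1}` ladder thus holds on the CLOSED range `(1/2, 5/2]`, whereas
the `Ḣ^s` ladder L52–L58 stops at `s < 5/2`. [cite: MccormickEtAl2016, Thm. 1.1] -/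
theorem ladder_clock_five_halves :
    ∃ c : ℝ, 0 < c ∧ ∀ (ν T : ℝ), 0 < ν → 0 < T →
      ∀ (u : ℝ → EuclideanSpace ℝ (Fin 3) → EuclideanSpace ℝ (Fin 3)) (p : ℝ → EuclideanSpace ℝ (Fin 3) → ℝ),
      IsMaximalSmoothSolution ν 0 u p T → IsLerayHopfOn T ν 0 (u 0) u →
      ∀ t ∈ Ioo 0 T,
        ENNReal.ofReal (c * ν ^ ((5 - 2 * (5 / 2 : ℝ)) / 4) * (T - t) ^ (-((2 * (5 / 2 : ℝ) - 1) / 4))) ≤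
          ∑' j : ℤ, (2 : ℝ≥0∞) ^ ((5 / 2 : ℝ) * (j : ℝ)) * blockL2 (u t) j := by
  obtain ⟨c, hc, H⟩ := lipRow_clock
  refine ⟨c, hc, fun ν T hν hT u p hmax hLH t ht => ?_⟩
  have h := H ν T hν hT u p hmax hLH t ht
  norm_num
  exact h

/-- **THE `ℓ¹` / `Ḃ^s_{2,1}` LADDER ON THE CLOSED RANGE `1/2 < s ≤ 5/2`** (one statement for the writer): for every
`s ∈ (1/2, 5/2]` one `c_s > 0` with `c_s · ν^{(5−2s)/4} · (T − t)^{−(2s−1)/4} ≤ ∑_j 2^{sj} ‖Δ̇_j u(t)‖₂` at every `t ∈ (0, T)`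
along every maximal smooth Leray–Hopf solution of the unforced system — L51 (`s ≤ 3/2`, `SobolevLadder.ladder_clock`),
`ladder_clock_range` (`s < 5/2`) and L61 (`s = 5/2`, where the power of `ν` is `0` and the rate `(2s−1)/4 = 1` is
absolute). [cite: RobinsonSadowskiSilva2012, (1.2), §IV] [cite: MccormickEtAl2016, Thm. 1.1] -/
theorem ladder_clock_full (s : ℝ) (hs : s ∈ Ioc (1 / 2 : ℝ) (5 / 2)) :
    ∃ c : ℝ, 0 < c ∧ ∀ (ν T : ℝ), 0 < ν → 0 < T →
      ∀ (u : ℝ → EuclideanSpace ℝ (Fin 3) → EuclideanSpace ℝ (Fin 3)) (p : ℝ → EuclideanSpace ℝ (Fin 3) → ℝ),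
      IsMaximalSmoothSolution ν 0 u p T → IsLerayHopfOn T ν 0 (u 0) u →
      ∀ t ∈ Ioo 0 T,
        ENNReal.ofReal (c * ν ^ ((5 - 2 * s) / 4) * (T - t) ^ (-((2 * s - 1) / 4))) ≤
          ∑' j : ℤ, (2 : ℝ≥0∞) ^ (s * (j : ℝ)) * blockL2 (u t) j := by
  rcases hs.2.eq_or_lt with h52 | h52
  · subst h52
    exact ladder_clock_five_halves
  · exact ladder_clock_range s ⟨hs.1, h52⟩

/-- **Every `ℓ¹` row `s ∈ (1/2, 5/2]` tends to `∞` as `t ↑ T`** along every maximal smooth Leray–Hopf solution of the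
unforced system (`ν > 0`). [cite: RobinsonSadowskiSilva2012, (1.2), §IV] [cite: MccormickEtAl2016, Thm. 1.1] -/
theorem ladder_tendsto_top_range (s : ℝ) (hs : s ∈ Ioc (1 / 2 : ℝ) (5 / 2)) {ν T : ℝ} (hν : 0 < ν) (hT : 0 < T)
    {u : ℝ → EuclideanSpace ℝ (Fin 3) → EuclideanSpace ℝ (Fin 3)} {p : ℝ → EuclideanSpace ℝ (Fin 3) → ℝ}
    (hmax : IsMaximalSmoothSolution ν 0 u p T) (hLH : IsLerayHopfOn T ν 0 (u 0) u) :
    Tendsto (fun t => ∑' j : ℤ, (2 : ℝ≥0∞) ^ (s * (j : ℝ)) * blockL2 (u t) j) (𝓝[<] T) (𝓝 ∞) := by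
  rcases hs.2.eq_or_lt with h52 | h52
  · subst h52
    exact lipRow_tendsto_top hν hT hmax hLH
  · obtain ⟨c, hc, H⟩ := ladder_clock_range s ⟨hs.1, h52⟩
    refine tendsto_nhds_top_mono (tendsto_ofReal_clock_top (a := (5 - 2 * s) / 4) (T := T) hc hν
      (by linarith [hs.1] : (0 : ℝ) < (2 * s - 1) / 4)) ?_
    filter_upwards [Ioo_mem_nhdsLT hT] with t ht
    exact H ν T hν hT u p hmax hLH t ht

end Summit.NavierStokesRegularity.FluidComputer.LadderRangeL1

end
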